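import Mathlib
import HarnessLib
import Literature.MathematicalPhysics.StatisticalMechanics.LastScaleKernelSubTorusFRD
import Literature.MathematicalPhysics.StatisticalMechanics.FluctuationKernelComparisonMidTraceTorusFRD
import Literature.MathematicalPhysics.StatisticalMechanics.FlowIdentityTorus
import Literature.MathematicalPhysics.StatisticalMechanics.RenormalisationMapP2Fluct

/-!
# The FIRST-ORDER part of the `ℓ = 2` slot of the last integration step (F4Φ22), uniformly in `N`:
# `‖∫ y(Λ) dN(0,C̄) − ∫ y(Λ) dμ^{(q+h)}_{N+1}‖ ≤ c_y A⁻¹ · ((r₀+1)·8q_H·3^{(d+1)/2}·½(Σ|h|)²K⁽²⁾) · κ`,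
# `C̄ = ½(𝒞_{1+q,N+1} + 𝒞_{1+q+2h,N+1})`

Twin of `norm_integral_last_kernel_sub_le_of_torusFRD` (the `ℓ = 1` slot F4Φ2) for the midpoint pair of the
`ℓ = 2` comparison: `tayNormLE_fluct_mid_sub_fluct_trace_of_torusFRD` at `k = N` evaluated at `φ = 0`.

* **`norm_integral_last_kernel_mid_sub_le_of_torusFRD`**.

## References
* S. Adams, S. Buchholz, R. Kotecký, S. Müller, arXiv:1910.13564, Lemma 8.4, (12.15), Lemma 12.6
  [AdamsBuchholzKoteckyMuller2019].
* S. Buchholz, J. Funct. Anal. 275 (2018), Thm 4.5 [Buchholz2016].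
-/

noncomputable section

namespace Literature.MathematicalPhysics.StatisticalMechanics.GradientRG

open scoped BigOperators Classical
open Real Finset MeasureTheory
open Literature.MathematicalPhysics.StatisticalMechanics.GradientFRD
  (fourierCoeff cExt cExt_of_mem IsElliptic IsUnitSymm InShell iterDiff supNorm conv ellOp isElliptic_one)
open Literature.MathematicalPhysics.StatisticalMechanics.TorusPolymer (IsPolymer numBlocks isPolymer_univ)
open Literature.Barriers.CriticalPhenomena.LongRangePhi4.Polymer (IsConn)
open Literature.MathematicalPhysics.QuantumFieldTheory

variable {d M : ℕ} [NeZero M]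

section Package

variable {L N Mord R n ñ : ℕ} {θbar lam μ δ₁ δ₀ A𝒫 : ℝ}
    {𝒞 : Matrix (Fin d) (Fin d) ℝ → ℕ → (Fin d → ZMod M) → ℝ} {Mc : ℕ → ℝ}
    {Cα : (Fin d → ℕ) → ℕ → ℝ} {c C : ℝ} {Cℓ : ℕ → ℝ}

set_option maxHeartbeats 1600000 in
/-- **First-order part of the `ℓ = 2` slot of the last integration step, uniformly in `N`**: for one
`TorusFRD` package with the gap `d + 1 ≤ 2(ñ−n)`, symmetric `q`, `h` with `q, q+h, q+2h` in the ball
`Σ|·| ≤ T₀ ≤ ½` (`K T₀ ≤ log(1+ρ)`, `ρ < θ̄`), Hölder conjugates `p, q_H` with `p(1+ρ) ≤ 1+ρ''` (`ρ'' < θ̄`),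
and `y` with `‖y‖_N^{(A)} ≤ c_y`, `C^{r₀}`, `T_N^{Λ*}`-local:
`‖∫ y(Λ) dN(0, C̄) − ∫ y(Λ) dμ^{(q+h)}_{N+1}‖ ≤ c_y A⁻¹ ((r₀+1)(8q_H (3^{(d+1)/2} · ½(Σ|h|)² K⁽²⁾))) κ`,
`C̄ = ½(𝒞_{1+q,N+1} + 𝒞_{1+q+2h,N+1})`, `κ = A𝒫(ρ'')^{1/p}` — no dependence on `N`.
[cite: AdamsBuchholzKoteckyMuller2019, Lemma 8.4 / (12.15) / Lemma 12.6] -/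
theorem norm_integral_last_kernel_mid_sub_le_of_torusFRD
    (hd : 3 ≤ d) (hMord : 1 ≤ Mord) (hMR : Mord ≤ R) (hLodd : Odd L) (hL : 2 ^ (d + 3) + 16 * R ≤ L)
    (hM : M = L ^ N)
    (hθbar : 0 < θbar) (hlam : 0 < lam) (hn : 2 * Mord ≤ n) (hn2 : 2 ≤ n) (hnñ : n ≤ ñ)
    (hgap : d + 1 ≤ 2 * (ñ - n))
    (hc : 0 < c) (hC1 : 0 ≤ Cℓ 1) (hC2 : 0 ≤ Cℓ 2)
    (hallA : ∀ A : Matrix (Fin d) (Fin d) ℝ, IsElliptic (1 / 2 : ℝ) 2 A →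
        (∀ k, 1 ≤ k → k ≤ N + 1 →
          ∑ x : Fin d → ZMod M, 𝒞 A k x = 0 ∧ ∀ x, 𝒞 A k (-x) = 𝒞 A k x) ∧
        (∀ k, 1 ≤ k → k ≤ N + 1 → ∀ φ : (Fin d → ZMod M) → ℝ, ∑ x, φ x = 0 →
          0 ≤ ∑ x, ∑ y, φ x * 𝒞 A k (x - y) * φ y) ∧
        (∀ φ : (Fin d → ZMod M) → ℝ, ∑ x, φ x = 0 →
          ellOp A (conv (fun x => ∑ k ∈ Finset.Icc 1 (N + 1), 𝒞 A k x) φ) = φ) ∧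
        (∀ k, 1 ≤ k → k ≤ N → Mc k ≤ 0 ∧
          ∀ x : Fin d → ZMod M, ((L : ℝ) ^ k) / 2 ≤ (supNorm x : ℝ) →
            𝒞 A k x = Mc k) ∧
        (∀ k, 1 ≤ k → k ≤ N + 1 → ∀ B : Matrix (Fin d) (Fin d) ℝ, IsUnitSymm B →
          (∃ ε : ℝ, 0 < ε ∧ ∀ x : Fin d → ZMod M,
            ContDiffOn ℝ ⊤ (fun s : ℝ => 𝒞 (A + s • B) k x) (Set.Ioo (-ε) ε)) ∧
          ∀ α : Fin d → ℕ, ∑ i, α i ≤ n → ∀ ℓ : ℕ, ∀ x : Fin d → ZMod M,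
            abs (iteratedDeriv ℓ (fun s : ℝ => iterDiff α (𝒞 (A + s • B) k) x) 0)
              ≤ Cα α ℓ / (L : ℝ) ^ ((k - 1) * (d - 2 + ∑ i, α i))) ∧
        (∀ k, 1 ≤ k → k ≤ N + 1 → ∀ j : ℕ, ∀ κ : Fin d → ZMod M, κ ≠ 0 → InShell L j κ →
          (j < k →
            c / (L : ℝ) ^ (2 * (d + ñ) + 1) * (L : ℝ) ^ (2 * j)
                / (L : ℝ) ^ ((k - j) * (d - 1 + n)) ≤ (fourierCoeff (𝒞 A k) κ).re ∧
            ‖fourierCoeff (𝒞 A k) κ‖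
              ≤ C * (L : ℝ) ^ (2 * (d + ñ) + 1) * (L : ℝ) ^ (2 * j)
                  / (L : ℝ) ^ ((k - j) * (d - 1 + n))) ∧
          (k ≤ j →
            c / (L : ℝ) ^ (2 * (d + ñ) + 1) * (L : ℝ) ^ (2 * k)
                ≤ (fourierCoeff (𝒞 A k) κ).re ∧
            ‖fourierCoeff (𝒞 A k) κ‖ ≤ C * (L : ℝ) ^ (2 * k)) ∧
          ∀ B : Matrix (Fin d) (Fin d) ℝ, IsUnitSymm B → ∀ ℓ : ℕ, 1 ≤ ℓ →
            (j < k →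
              ‖iteratedDeriv ℓ (fun s : ℝ => fourierCoeff (𝒞 (A + s • B) k) κ) 0‖
                ≤ Cℓ ℓ * (L : ℝ) ^ (2 * (d + ñ) + 1) * (L : ℝ) ^ (2 * j)
                    / (L : ℝ) ^ ((k - j) * (d - 1 + ñ))) ∧
            (k ≤ j →
              ‖iteratedDeriv ℓ (fun s : ℝ => fourierCoeff (𝒞 (A + s • B) k) κ) 0‖
                ≤ Cℓ ℓ * (L : ℝ) ^ (2 * k))))
    (hB : AbkmWeightBounds L N Mord R n θbar lam μ δ₁ δ₀ A𝒫 (fun j => 𝒞 1 j)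
      (abkmWeightData L N Mord R θbar (schedDelta δ₀ δ₁ N) fun j => 𝒞 1 j))
    {ρ : ℝ} (hρ0 : 0 ≤ ρ) (hρ : ρ < θbar)
    {T₀ : ℝ} (hT₀ : T₀ ≤ 1 / 2) (hKT₀ : shellRatioConst c (Cℓ 1) (L : ℝ) d ñ * T₀ ≤ Real.log (1 + ρ))
    {q yq : Matrix (Fin d) (Fin d) ℝ} (hq : q.IsSymm) (hh : yq.IsSymm)
    (hqT : ∑ i, ∑ j, |q i j| ≤ T₀) (hqhT : ∑ i, ∑ j, |(q + yq) i j| ≤ T₀)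
    (hq2hT : ∑ i, ∑ j, |(q + (2 : ℝ) • yq) i j| ≤ T₀)
    {p qH ρ'' : ℝ} (hpq : p.HolderConjugate qH) (hρ''0 : 0 ≤ ρ'') (hρ'' : ρ'' < θbar)
    (hpρ : p * (1 + ρ) ≤ 1 + ρ'')
    {pT r₀ : ℕ} {h A : ℝ} (hA : 0 < A)
    {y : Finset (Fin d → ZMod M) → ((Fin d → ZMod M) → ℝ) → ℂ} {cy : ℝ} (hcy : 0 ≤ cy)
    (hy : WeakNormLE (abkmNormParams L N Mord R pT r₀ h θbar A (schedDelta δ₀ δ₁ N) fun j => 𝒞 1 j) N y cy)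
    (hyd : ContDiff ℝ r₀ (y univ))
    (hyloc : IsGaugeLocal ((abkmNormParams L N Mord R pT r₀ h θbar A (schedDelta δ₀ δ₁ N) fun j => 𝒞 1 j).gauge N univ)
      (y univ)) :
    ‖(∫ φ, y univ φ ∂(stepMeasure (fun x => 2⁻¹ * 𝒞 ((1 : Matrix (Fin d) (Fin d) ℝ) + q) (N + 1) x +
          2⁻¹ * 𝒞 ((1 : Matrix (Fin d) (Fin d) ℝ) + (q + (2 : ℝ) • yq)) (N + 1) x))) -
        ∫ φ, y univ φ ∂(stepMeasure (𝒞 ((1 : Matrix (Fin d) (Fin d) ℝ) + (q + yq)) (N + 1)))‖ ≤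
      cy * A⁻¹ * ((r₀ + 1) * (8 * qH *
          (Real.sqrt ((3 : ℝ) ^ (d + 1)) *
            (2⁻¹ * (∑ i, ∑ j, |yq i j|) ^ 2 * shellRatioConst c (Cℓ 2) (L : ℝ) d ñ)))) *
        weightIntConstRho θbar ρ'' (traceConst d Mord R lam (derivSum d n fun θ' _ => Cα θ' 0)) ^ (1 / p) := by
  set P := abkmNormParams L N Mord R pT r₀ h θbar A (schedDelta δ₀ δ₁ N) fun j => 𝒞 1 j with hP
  set W := abkmWeightData L N Mord R θbar (schedDelta δ₀ δ₁ N) fun j => 𝒞 1 j with hW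
  have hMo : Odd M := by rw [hM]; exact hLodd.pow
  have hne : (univ : Finset (Fin d → ZMod M)).Nonempty := Finset.univ_nonempty
  have hLN : L ^ N = M := hM.symm
  have hΛp : IsPolymer (L ^ N) (univ : Finset (Fin d → ZMod M)) := isPolymer_univ _
  have hΛc : IsConn (univ : Finset (Fin d → ZMod M)) := isConn_top_univ hMo
  have hnb : numBlocks (L ^ N) (univ : Finset (Fin d → ZMod M)) = 1 := by
    rw [hLN]; exact numBlocks_top_univ hMo hne
  have haF : P.aFactor N univ = A⁻¹ := by
    unfold NormParams.aFactor
    rw [abkmNormParams_A, abkmNormParams_L, hnb, pow_one]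
  -- the Taylor-norm bound of `y(Λ)` and the dimension-free Lemma 8.4 at the last scale `k = N`
  have hb : TayNormLE (P.gauge N univ) r₀ (W.weight N univ) (y univ) (cy * P.aFactor N univ) := hy univ hΛp hΛc
  rw [haF] at hb
  have hb0 : 0 ≤ cy * A⁻¹ := mul_nonneg hcy (inv_pos.2 hA).le
  have hmain := tayNormLE_fluct_mid_sub_fluct_trace_of_torusFRD hd hMord hMR hLodd hL hM hθbar hlam hn hn2 hnñ hgap hc
    hC1 hC2 hallA hB (k := N) le_rfl hρ0 hρ hT₀ hKT₀ hq hh hqT hqhT hq2hT hpq hρ''0 hρ'' hpρ hΛp hb0 hyd hyloc hb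
    (pT := pT) (r₀ := r₀) (h := h) (A := A)
  -- evaluate at `φ = 0`: order zero of the Taylor norm, `w_{N:N+1}^Λ(0) = 1`, `|Λ|_N = 1`, `L^0 = 1`
  have hloc : IsGaugeLocal (P.gauge N univ)
      (fluct (fun x => 2⁻¹ * 𝒞 ((1 : Matrix (Fin d) (Fin d) ℝ) + q) (N + 1) x +
          2⁻¹ * 𝒞 ((1 : Matrix (Fin d) (Fin d) ℝ) + (q + (2 : ℝ) • yq)) (N + 1) x) (y univ) -
        fluct (𝒞 ((1 : Matrix (Fin d) (Fin d) ℝ) + (q + yq)) (N + 1)) (y univ)) := by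
    intro φ ψ hφψ
    rw [Pi.sub_apply, Pi.sub_apply, isGaugeLocal_fluct _ _ hyloc φ ψ hφψ, isGaugeLocal_fluct _ _ hyloc φ ψ hφψ]
  have h0 := norm_apply_le_tayNorm r₀ hloc (0 : (Fin d → ZMod M) → ℝ)
  have h1 := hmain 0
  have hmid : W.midWeight N univ 0 = 1 := by simp [WeightData.midWeight]
  have hNN : (N - (N + 1)) * d = 0 := by simp
  rw [hmid, mul_one, hnb, pow_one, hNN, pow_zero, mul_one] at h1
  rw [Pi.sub_apply, fluct_zero_eq_integral, fluct_zero_eq_integral] at h0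
  exact h0.trans h1

end Package

end Literature.MathematicalPhysics.StatisticalMechanics.GradientRG

end
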